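import Summits.BirchSwinnertonDyer.BirchSwinnertonDyer.Theorems.ByReductionTypeAtTwoAdditiveKatoFineConjAReducible
import Literature.NumberTheory.EllipticCurves.FourTorsionHalvingProofs
import Literature.NumberTheory.EllipticCurves.PointDivisibilityProofs
import HarnessLib

/-!
# Route `ByReductionTypeAtTwo` (rung K4), crux `AdditiveRankZeroAtTwo` (item stmt-BirchSwinnertonDyer-19098),
# line add_twist_overK v2, stub `stub_addDefectUpper` (hU3): `√−1 ∈ K(E[4])` for every elliptic curve, and the
# HONEST Lim@2 carrier `ℚ(E[2], √−1) ≤ ℚ(E[4])` of `2`-power index — the totally imaginary witness field of the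
# 2026-08-28 scope rider SUPPLIED IN THE KERNEL for every curve (a `--supports` file; seat `bsd-2adic-addL2x` GEN 9;
# sequel of `…KatoFineConjAReducible.lean`; outside the route file's import cone)

HONEST FRAMING (cell `bsd-2adic`, HUMAN RULING D-0036/D-0054): types-the-object-of; closes none at the ∀-level;
nothing booked; BSD is not proved by any of this. §1–§2 are PROVED outright (pure algebra of the `4`-torsion);
§3 is CONDITIONAL only on the PRINT facts it names (`hLim2`, `hFuk`).

WHY. Every consumer of `Lim2017.thm35_at_two_fineSelmerDual_moduleFinite_of_classicalMuVanishes_of_le_divisionField_four`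
displays a witness `L ≤ ℚ(E[4])` with `[ℚ(E[4]) : ℚ] = 2^k·[L : ℚ]`, and by the fact's scope rider (2026-08-28) the
honest witnesses are the TOTALLY IMAGINARY ones, «e.g. `L := ℚ(e₁, i) ≤ ℚ(E[4])`» — but `i ∈ ℚ(E[4])` was nowhere in
the tree for `WeierstrassCurve.divisionField` (the Weil pairing `e₄`, whose Galois-equivariance gives
`μ₄ ⊂ ℚ(E[4])`, is a hypothesis in every tree file that mentions it), so `L`, `L ≤ ℚ(E[4])` and the index stayed
DISPLAYED hypotheses (`hL`, `hdeg`) in the additive doors (`conjA_two_of_fukudaCertificate`, the 8092j rungs) and the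
cell bsd-f1-sign2 typed Lim's theorem a second time UPSTAIRS on the carrier `ℚ(E[2]) ⊔ ℚ⟮i⟯`
(`thm35_at_two_upstairs_…`) precisely because that carrier could not be placed inside `ℚ(E[4])`. This file proves
`√−1 ∈ K(E[4])` WITHOUT the Weil pairing, from the halving identity already in the tree
(`DokchitserDokchitser2012.four_mul_sq_xco_sub_eq`: `4(x(Q) − e_k)² = u_k` for `2Q = T_k`, and `prod_uT`:
`u₀u₁u₂ = −64 δ²`, `δ = ∏_{j<k}(e_j − e_k) ≠ 0`): with `Q_k` a half of the `2`-torsion point `T_k` (`k = 0,1,2`;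
halves exist, `[2]` is onto `E(K̄)`), the element `i := ∏_k 2(x(Q_k) − e_k) / (8δ)` satisfies `i² = −1`, and it lies in
`K(E[4])` because the `x(Q_k)` (`Q_k ∈ E[4]`), the `e_k` and `δ` do. Classical content: «`ℚ(E[4]) ⊇ ℚ(√(e_j − e_k)
(all `j ≠ k`)) ∋ √(e₁−e₂)/√(e₂−e₁) = ±i`» (e.g. [LiTianYanZhu2025] §7's `F(E_4) ∋ i`; Serre 1972 §IV via `det ρ̄₄ = χ₄`).

* §1 (any field `K` with `2 ≠ 0`, `E/K` elliptic) `xco_mem_divisionField_of_nsmul_eq_zero` — `x(P) ∈ K(E[n])` for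
  `nP = O`; `exists_sq_eq_neg_one_mem_divisionField_four` — **some `i ∈ K(E[4])` has `i² = −1`**;
  `mem_divisionField_four_of_sq_eq_neg_one` — hence EVERY `i ∈ K̄` with `i² = −1` lies in `K(E[4])`.
* §2 (`K = ℚ`) `divisionField_two_sup_adjoin_le_divisionField_four` — `ℚ(E[2], i) ≤ ℚ(E[4])`;
  `exists_finrank_divisionField_four_eq_pow_mul_of_le` — every `L` with `ℚ(E[2]) ≤ L ≤ ℚ(E[4])` has
  `[ℚ(E[4]) : ℚ] = 2^j·[L : ℚ]` (`Gal(ℚ(E[4])/ℚ(E[2]))` is a `2`-group: tree `divisionTowerTwoFour` + Mathlib `relfinrank`);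
  `exists_finrank_divisionField_four_eq_pow_mul_divisionField_two_sup_adjoin` — in particular for `L = ℚ(E[2], i)`.
* §3 (`K = ℚ`, doors) `conjA_two_of_classicalMu_divisionField_two_adjoin_I` — **statement (A) at `(W,2)` for ANY elliptic
  `W/ℚ` from Iwasawa's classical `μ₂ = 0` along the cyclotomic `ℤ₂`-towers of the totally imaginary field `ℚ(E[2], i)`**,
  granted Lim@2 (`hLim2`) BY NAME, with Lim's two hypotheses on the carrier DISCHARGED (§2) — the honest downstairs road
  for either sign of `Δ_E`; `conjA_two_of_fukudaCertificate_divisionField_two_adjoin_I` — the same with the `μ₂ = 0`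
  input replaced by a Fukuda class-group certificate on that carrier (`hFuk` BY NAME), i.e. GEN 8's
  `conjA_two_of_fukudaCertificate` with (`L`, `hL`, `hdeg`) no longer displayed (kit base «M(i)» of the GEN 8 census).

References: [Lim2017FineSelmer] §3 Thm. 3.5, Lemma 3.2 (carrier `L ⊆ F(E[4])`); [SilvermanAEC2009] III.2.3 (d), Ex. III.3.7,
VIII.§1; [Serre1972] §IV; [DokchitserDokchitserMathZ2012] Lemma p. 962 (halves of the `2`-torsion); [Fukuda1994] Thm. 1 (2);
[CoatesSujatha2005] statement (A). Memo: `run/shared/lean/pub/bsd-2adic/addL2x/VERDICT-19098-addL2x-GEN9.md`.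
-/

set_option autoImplicit false
-- sibling precedent (`ByReductionTypeAtTwoAdditiveKatoFineConjAReducible.lean`): the directory name repeats the summit name
set_option linter.dupNamespace false

noncomputable section

open scoped Classical

namespace Summit.BirchSwinnertonDyer.BirchSwinnertonDyer.Theorems.AddKatoTwo

open WeierstrassCurve Field Literature.NumberTheory.EllipticCurves
  Literature.NumberTheory.EllipticCurves.DokchitserDokchitser2012
  Literature.NumberTheory.EllipticCurves.Rank1Residual
  Literature.NumberTheory.EllipticCurves.Rank1Residual.Typed
  Literature.NumberTheory.IwasawaTheory
  Summit.BirchSwinnertonDyer.Rank1Residual.X5.AddTwoL2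

universe u

/-! ## §1 `√−1 ∈ K(E[4])` (any field `K` with `2 ≠ 0`) -/

section General

variable {K : Type u} [Field K] (W : WeierstrassCurve K) [W.IsElliptic]

omit [W.IsElliptic] in
/-- **The abscissa of an `n`-torsion point lies in `K(E[n])`**: if `nP = O` in `E(K̄)` then `x(P) ∈ K(E[n])` — an
automorphism fixing `E[n]` pointwise fixes `P`, hence its coordinates (`x(σP) = σ x(P)`).
[cite: SilvermanAEC2009, VIII.§1 (G_{K̄/K} acts on E(K̄) coordinatewise)] -/
theorem xco_mem_divisionField_of_nsmul_eq_zero {n : ℕ} [NeZero n] {P : geomPoints W}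
    (hP : n • P = 0) : xco W P ∈ W.divisionField n := by
  rw [mem_divisionField_iff]
  intro σ hσ
  have hmem : P ∈ geomTorsion W (n : ℤ) := by
    rw [geomTorsion, AddSubgroup.torsionBy.nsmul_iff]
    exact hP
  have h := congrArg (fun T : geomTorsion W (n : ℤ) => (T : geomPoints W)) (hσ ⟨P, hmem⟩)
  have h' : σ • P = P := h
  rw [← xco_smul, h']

/-- **Some square root of `−1` lies in the `4`-division field `K(E[4])`** (`E/K` elliptic, `2 ≠ 0` in `K`). With
`T₀, T₁, T₂` the points of order `2`, `e_k = x(T_k)`, `δ = (e₀−e₁)(e₀−e₂)(e₁−e₂)` and `Q_k ∈ E(K̄)` with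
`2Q_k = T_k` (so `Q_k ∈ E[4]`): the halving identity `4(x(Q_k) − e_k)² = u_k` and `u₀u₁u₂ = −64δ²` give
`(∏_k 2(x(Q_k) − e_k))² = −(8δ)²`, so `i := ∏_k 2(x(Q_k) − e_k)/(8δ)` has `i² = −1`; and `x(Q_k), e_k, δ ∈ K(E[4])`.
No Weil pairing is used. [cite: SilvermanAEC2009, III.2.3 (d) and Ex. III.3.7 (duplication formula, 2-division cubic)]
[cite: DokchitserDokchitserMathZ2012, Lemma (p. 962) (abscissae of the halves of the 2-torsion points)]
[cite: Serre1972, §IV (ℚ(E[4]) ∋ √−1 via det ρ̄₄)] -/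
theorem exists_sq_eq_neg_one_mem_divisionField_four (h2 : (2 : K) ≠ 0) :
    ∃ i : AlgebraicClosure K, i ^ 2 = -1 ∧ i ∈ W.divisionField 4 := by
  have h2' : (2 : AlgebraicClosure K) ≠ 0 := fun h0 ↦
    h2 ((algebraMap K (AlgebraicClosure K)).injective (by rw [map_ofNat, h0, map_zero]))
  have h8 : (8 : AlgebraicClosure K) ≠ 0 := by
    rw [show (8 : AlgebraicClosure K) = 2 ^ 3 by norm_num]; exact pow_ne_zero 3 h2'
  -- halves `Q_k` of the three `2`-torsion points
  have half : ∀ k : Fin 3, ∃ Q : geomPoints W, Q + Q = (T W h2 k : geomPoints W) := fun k ↦ by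
    obtain ⟨Q, hQ⟩ := W.exists_nsmul_eq_geomPoints W.zsmul_geomPoints_surjective_holds two_ne_zero
      (T W h2 k : geomPoints W)
    exact ⟨Q, by rw [← two_nsmul]; exact hQ⟩
  choose Q hQ using half
  -- the halving identity `4 (x(Q_k) - e_k)^2 = u_k`
  have hsq : ∀ k : Fin 3, 4 * (xco W (Q k) - xT W h2 k) ^ 2 = uT W h2 k := fun k ↦
    four_mul_sq_xco_sub_eq W (coe_T_ne_zero W h2 k) (coe_add_self_eq_zero W (T W h2 k)) (hQ k)
  set a : Fin 3 → AlgebraicClosure K := fun k ↦ 2 * (xco W (Q k) - xT W h2 k) with ha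
  have ha2 : ∀ k : Fin 3, a k ^ 2 = uT W h2 k := fun k ↦ by rw [ha]; dsimp only; rw [← hsq k]; ring
  have hprod : (a 0 * a 1 * a 2) ^ 2 = -64 * delta W h2 ^ 2 := by
    rw [← prod_uT W h2, ← ha2 0, ← ha2 1, ← ha2 2]; ring
  have hden : (8 : AlgebraicClosure K) * delta W h2 ≠ 0 := mul_ne_zero h8 (delta_ne_zero W h2)
  refine ⟨a 0 * a 1 * a 2 / (8 * delta W h2), ?_, ?_⟩
  · rw [div_pow, hprod, div_eq_iff (pow_ne_zero 2 hden)]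
    ring
  · -- membership in `K(E[4])`
    have h2T : ∀ k : Fin 3, 2 • (T W h2 k : geomPoints W) = 0 := fun k ↦ by
      rw [two_nsmul]; exact coe_add_self_eq_zero W (T W h2 k)
    have h4T : ∀ k : Fin 3, (4 : ℕ) • (T W h2 k : geomPoints W) = 0 := fun k ↦ by
      rw [show (4 : ℕ) = 2 * 2 from rfl, mul_nsmul, h2T k, nsmul_zero]
    have h4Q : ∀ k : Fin 3, (4 : ℕ) • Q k = 0 := fun k ↦ by
      rw [show (4 : ℕ) = 2 * 2 from rfl, mul_nsmul, two_nsmul (Q k), hQ k, h2T k]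
    have hx : ∀ k : Fin 3, xco W (Q k) ∈ W.divisionField 4 := fun k ↦
      xco_mem_divisionField_of_nsmul_eq_zero W (h4Q k)
    have he : ∀ k : Fin 3, xT W h2 k ∈ W.divisionField 4 := fun k ↦
      xco_mem_divisionField_of_nsmul_eq_zero W (h4T k)
    have hak : ∀ k : Fin 3, a k ∈ W.divisionField 4 := fun k ↦
      mul_mem (ofNat_mem _ 2) (sub_mem (hx k) (he k))
    have hδ : delta W h2 ∈ W.divisionField 4 := by
      rw [delta]
      exact mul_mem (mul_mem (sub_mem (he 0) (he 1)) (sub_mem (he 0) (he 2))) (sub_mem (he 1) (he 2))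
    exact div_mem (mul_mem (mul_mem (hak 0) (hak 1)) (hak 2)) (mul_mem (ofNat_mem _ 8) hδ)

/-- **Every square root of `−1` in `K̄` lies in `K(E[4])`** (`E/K` elliptic, `2 ≠ 0` in `K`): the two roots of
`X² + 1` are `± i` with `i` as in `exists_sq_eq_neg_one_mem_divisionField_four`. [cite: Serre1972, §IV]
[cite: SilvermanAEC2009, III.2.3 (d) and Ex. III.3.7] -/
theorem mem_divisionField_four_of_sq_eq_neg_one (h2 : (2 : K) ≠ 0) {i : AlgebraicClosure K}
    (hi : i ^ 2 = -1) : i ∈ W.divisionField 4 := by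
  obtain ⟨i₀, hi₀, hmem⟩ := exists_sq_eq_neg_one_mem_divisionField_four W h2
  have hzero : (i - i₀) * (i + i₀) = 0 := by
    have : i ^ 2 - i₀ ^ 2 = 0 := by rw [hi, hi₀, sub_self]
    linear_combination this
  rcases mul_eq_zero.mp hzero with h | h
  · rw [sub_eq_zero.mp h]; exact hmem
  · rw [eq_neg_of_add_eq_zero_left h]; exact neg_mem hmem

end General

/-! ## §2 The carrier `ℚ(E[2], i) ≤ ℚ(E[4])` has `2`-power index -/

/-- **`ℚ(E[2], i) ≤ ℚ(E[4])`** for every elliptic `W/ℚ` and `i ∈ ℚ̄` with `i² = −1` (`ℚ(E[2]) ≤ ℚ(E[4])` by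
`divisionTowerTwoFour`, `i ∈ ℚ(E[4])` by §1). [cite: Lim2017FineSelmer, §3 Thm. 3.5 (hypothesis L ⊆ F(E[4]))]
[cite: Serre1972, §IV] -/
theorem divisionField_two_sup_adjoin_le_divisionField_four (W : WeierstrassCurve ℚ) [W.IsElliptic]
    {i : AlgebraicClosure ℚ} (hi : i ^ 2 = -1) :
    W.divisionField 2 ⊔ IntermediateField.adjoin ℚ {i} ≤ W.divisionField 4 := by
  refine sup_le (SignedMuAtTwo.ResolventEllipticUnits.divisionTowerTwoFour W).1 ?_
  rw [IntermediateField.adjoin_le_iff, Set.singleton_subset_iff]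
  exact mem_divisionField_four_of_sq_eq_neg_one W two_ne_zero hi

/-- **Every field between `ℚ(E[2])` and `ℚ(E[4])` has `2`-power index in `ℚ(E[4])`**: for
`ℚ(E[2]) ≤ L ≤ ℚ(E[4])`, `[ℚ(E[4]) : ℚ] = 2^j·[L : ℚ]` — `[ℚ(E[4]) : L]` divides `[ℚ(E[4]) : ℚ(E[2])] = 2^k`
(`divisionTowerTwoFour`; Mathlib `relfinrank`). [cite: Serre1972, §IV (the kernel of GL₂(ℤ/4) → GL₂(ℤ/2) is a 2-group)]
[cite: Lim2017FineSelmer, §3 Thm. 3.5 (hypothesis on L)] -/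
theorem exists_finrank_divisionField_four_eq_pow_mul_of_le (W : WeierstrassCurve ℚ) [W.IsElliptic]
    (L : IntermediateField ℚ (AlgebraicClosure ℚ)) (h2L : W.divisionField 2 ≤ L) (hL4 : L ≤ W.divisionField 4) :
    ∃ j : ℕ, Module.finrank ℚ (W.divisionField 4) = 2 ^ j * Module.finrank ℚ L := by
  obtain ⟨h24, k, hk⟩ := SignedMuAtTwo.ResolventEllipticUnits.divisionTowerTwoFour W
  have hpos : 0 < Module.finrank ℚ (W.divisionField 2) := Module.finrank_pos
  have h1 := IntermediateField.finrank_bot_mul_relfinrank h24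
  have hrel : IntermediateField.relfinrank (W.divisionField 2) (W.divisionField 4) = 2 ^ k := by
    apply Nat.eq_of_mul_eq_mul_left hpos
    rw [h1, hk, mul_comm]
  have hdvd : IntermediateField.relfinrank L (W.divisionField 4) ∣ 2 ^ k :=
    hrel ▸ IntermediateField.relfinrank_dvd_of_le_left (C := W.divisionField 4) h2L
  obtain ⟨j, -, hj⟩ := (Nat.dvd_prime_pow Nat.prime_two).mp hdvd
  refine ⟨j, ?_⟩
  have h2 := IntermediateField.finrank_bot_mul_relfinrank hL4
  rw [hj, mul_comm] at h2
  exact h2.symm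

/-- **`[ℚ(E[4]) : ℚ] = 2^j · [ℚ(E[2], i) : ℚ]`** for every elliptic `W/ℚ` and `i² = −1` — Lim's second carrier hypothesis
at `p = 2` for the totally imaginary field `ℚ(E[2], i)`. [cite: Lim2017FineSelmer, §3 Thm. 3.5 (hypothesis on L)]
[cite: Serre1972, §IV] -/
theorem exists_finrank_divisionField_four_eq_pow_mul_divisionField_two_sup_adjoin (W : WeierstrassCurve ℚ)
    [W.IsElliptic] {i : AlgebraicClosure ℚ} (hi : i ^ 2 = -1) :
    ∃ j : ℕ, Module.finrank ℚ (W.divisionField 4) =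
      2 ^ j * Module.finrank ℚ ↥(W.divisionField 2 ⊔ IntermediateField.adjoin ℚ {i}) :=
  exists_finrank_divisionField_four_eq_pow_mul_of_le W _ le_sup_left
    (divisionField_two_sup_adjoin_le_divisionField_four W hi)

/-! ## §3 Doors: statement (A) at `(E, 2)` along the honest carrier `ℚ(E[2], i)`, for EVERY curve -/

/-- **Statement (A) at `(W, 2)` from Iwasawa's classical `μ₂ = 0` for the totally imaginary field `ℚ(E[2], i)`**, for ANY
elliptic `W/ℚ` (either sign of `Δ_E`, any image of `ρ̄_{E,2}`), granted Lim 2017 Thm. 3.5 at `p = 2` (`hLim2`) BY NAME —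
Lim's two carrier hypotheses `L ≤ ℚ(E[4])`, `[ℚ(E[4]) : ℚ] = 2^j·[L : ℚ]` are DISCHARGED (§2). This is the honest
downstairs road singled out by the fact's 2026-08-28 scope rider («instantiate `L ∋ √−1`»). `∃ γ D` spelling.
[cite: Lim2017FineSelmer, §3 Thm. 3.5 and Lemma 3.2] [cite: CoatesSujatha2005, statement (A) and Thm. 3.4] -/
theorem conjA_two_of_classicalMu_divisionField_two_adjoin_I
    (hLim2 : Lim2017.thm35_at_two_fineSelmerDual_moduleFinite_of_classicalMuVanishes_of_le_divisionField_four)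
    (W : WeierstrassCurve ℚ) [W.IsElliptic] {i : AlgebraicClosure ℚ} (hi : i ^ 2 = -1)
    (hμ : ∀ κL : ZpExtension ↥(W.divisionField 2 ⊔ IntermediateField.adjoin ℚ {i}) 2,
      κL.IsCyclotomic → ClassicalMuVanishes κL) :
    ∀ (κ : ZpExtension ℚ 2), κ.IsCyclotomic →
      ∃ (γ : Field.absoluteGaloisGroup ℚ) (D : W.FineSelmerDualData κ γ),
        Module.Finite ℤ_[2] (RestrictScalars ℤ_[2] (IwasawaAlgebra 2) D.X) :=
  hLim2 W _ (divisionField_two_sup_adjoin_le_divisionField_four W hi)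
    (exists_finrank_divisionField_four_eq_pow_mul_divisionField_two_sup_adjoin W hi) hμ

/-- **Statement (A) at `(W, 2)` from a Fukuda class-group certificate on the carrier `ℚ(E[2], i)`** (any elliptic `W/ℚ`;
`hLim2`, `hFuk` BY NAME): total ramification of every cyclotomic `ℤ₂`-tower of `ℚ(E[2], i)` from layer `n₀` and
`rank₂ Cl(L_{n₀+1}) = rank₂ Cl(L_{n₀})` (the displayed certificate `hcert`, GRH class groups of degree `12·2^{n₀}`-ish
fields in the `S₃` case — kit base «M(i)» of the GEN 8 census) ⇒ `μ₂ = 0` (Fukuda 1994 Thm. 1 (2)) ⇒ (A)`(W,2)`. GEN 8's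
`conjA_two_of_fukudaCertificate` with `L`, `hL`, `hdeg` supplied. [cite: Fukuda1994, Thm. 1 (2), p. 264]
[cite: Lim2017FineSelmer, §3 Thm. 3.5 and Lemma 3.2] [cite: CoatesSujatha2005, statement (A)] -/
theorem conjA_two_of_fukudaCertificate_divisionField_two_adjoin_I
    (hLim2 : Lim2017.thm35_at_two_fineSelmerDual_moduleFinite_of_classicalMuVanishes_of_le_divisionField_four)
    (hFuk : fukuda1994_thm1_classGroupPRank_const_of_succ_eq)
    (W : WeierstrassCurve ℚ) [W.IsElliptic] {i : AlgebraicClosure ℚ} (hi : i ^ 2 = -1) (n₀ : ℕ)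
    (hcert : ∀ κL : ZpExtension ↥(W.divisionField 2 ⊔ IntermediateField.adjoin ℚ {i}) 2, κL.IsCyclotomic →
      TotallyRamifiedFrom κL n₀ ∧ classGroupPRank κL (n₀ + 1) = classGroupPRank κL n₀) :
    ∀ (κ : ZpExtension ℚ 2), κ.IsCyclotomic →
      ∃ (γ : Field.absoluteGaloisGroup ℚ) (D : W.FineSelmerDualData κ γ),
        Module.Finite ℤ_[2] (RestrictScalars ℤ_[2] (IwasawaAlgebra 2) D.X) :=
  conjA_two_of_fukudaCertificate hLim2 hFuk W _ (divisionField_two_sup_adjoin_le_divisionField_four W hi)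
    (exists_finrank_divisionField_four_eq_pow_mul_divisionField_two_sup_adjoin W hi) n₀ hcert

end Summit.BirchSwinnertonDyer.BirchSwinnertonDyer.Theorems.AddKatoTwo

end
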